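import Summits.PneNP.PneNP.Theses.PhaseTwins
import Summits.PneNP.PneNP.Theorems.PhaseTwinsHardcoreCountSharpPCanon
import Summits.PneNP.PneNP.Theorems.PhaseTwinsHardcoreCountSharpPTests
import Literature.Computability.Complexity.HardcoreInapproximability
import Literature.Computability.Complexity.GapNatPSpace
import Literature.Computability.QuantumComplexity.GapPClosure

/-!
# PneNP / PhaseTwins — `HardcoreCountSharpP` (stmt-PneNP-2722), part 3: the hard-core count is in `#P`

Route `PneNP/PhaseTwins`, support item stmt-PneNP-2722 (`HardcoreCountSharpP`, the first hypothesis
of the route's Assembly): for all `Δ, p, q` the counting function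
`N(x) = Σ_{I independent in G_x} p^{|I|} q^{n-|I|}` on codes `x` of graphs `G_x` on `n` vertices with
maximum degree `≤ Δ` (`0` off the promise) — the tree's `hardcoreCount Δ p q`
(`HardcoreInapproximability.lean`, the same term as the function inlined in the route) — is in
Valiant's `#P` (`SharpP`, `Counting.lean`).

Proof (Valiant 1979 §2 / Arora–Barak Def. 17.2, by the closure properties of `#P` proved in the
tree rather than by a hand-built witness relation):

  `N = (y ↦ Σ_{z ∈ {0,1}^{|gLen y|}} [⟨y, z⟩ ∈ testLang Δ] · p^{|gP ⟨y,z⟩|} · q^{|gQ ⟨y,z⟩|}) ∘ canon`,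

where `canon = encode ∘ decode ∈ FP` (part 1, `PhaseTwinsHardcoreCountSharpPCanon.lean`),
`testLang Δ ∈ P` tests "maximum degree `≤ Δ` and the set `S_z` chosen by `z` is independent" and
`|gP| = |S_z|`, `|gQ| = n - |S_z|` (part 2, `PhaseTwinsHardcoreCountSharpPTests.lean`); membership is
`comp_mem_SharpP` (FP preprocessing, `SharpPClosure.lean`) ∘ `ParityClosure.sum_mem_SharpP` (uniform
exponential sums) ∘ `ParityClosure.ite_mem_SharpP` (`P` tests) ∘ `GapPRing.mul_mem_SharpP` ∘
`ParityClosure.prod_mem_SharpP` with `natConst_mem_SharpP` (uniform products of constants), and the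
identity of functions is the bijection between bit vectors `z ∈ {0,1}ⁿ` and vertex sets
`S_z ⊆ Fin n` (`sum_psi_encode`).

* `hardcoreCount_mem_SharpP : hardcoreCount Δ p q ∈ SharpP`;
* **`hardcoreCountSharpP_proof : Summit.PneNP.PneNP.Theses.PhaseTwins.HardcoreCountSharpP`** (the route
  decl unfolds to `∀ Δ p q, hardcoreCount Δ p q ∈ SharpP` by `rfl`).

References: L. G. Valiant, *The complexity of computing the permanent*, TCS 8 (1979), §2; S. Arora,
B. Barak, *Computational Complexity: A Modern Approach* (2009), Def. 17.2, §17.4.2 (arithmetic of `#P`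
functions); R. M. Karp, *Reducibility among combinatorial problems* (1972), §3 (graph encodings).
-/

noncomputable section

-- `Summit.PneNP.PneNP.…` duplicates `PneNP` BY DESIGN (single-problem summit, D-0017 layout).
set_option linter.dupNamespace false

namespace Summit.PneNP.PneNP.Theorems

open Literature.Computability.Complexity Computability Brick OracleCompose Plumb HashBricks Polynomial Finset

namespace HardcoreSharpP

open scoped Classical

/-! ### The `#P` function on canonical codes -/

/-- **`W ↦ p^{|g W|} ∈ #P`** for `g ∈ FP` (a uniform polynomial product of the constant `p`).
[cite: AroraBarak2009, §17.4.2 eq. (17.5)] -/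
theorem pow_length_mem_SharpP (p : ℕ) {g : List Bool → List Bool} (hg : g ∈ FP) :
    (fun W => p ^ (g W).length) ∈ SharpP := by
  have h := ParityClosure.prod_mem_SharpP (natConst_mem_SharpP p) hg
  simp only [prod_const, card_range] at h
  exact h

/-- The weight of a witness: `p^{#1(z)} · q^{|z| - #1(z)}`, written with the length functions `gP`, `gQ`.
[cite: Valiant1979, §2] -/
def weightFn (p q : ℕ) (W : List Bool) : ℕ := p ^ (gP W).length * q ^ (gQ W).length

/-- `weightFn p q ∈ #P`. [cite: AroraBarak2009, §17.4.2 eq. (17.5)] -/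
theorem weightFn_mem_SharpP (p q : ℕ) : weightFn p q ∈ SharpP :=
  Literature.Computability.QuantumComplexity.GapPRing.mul_mem_SharpP (pow_length_mem_SharpP p gP_mem_FP)
    (pow_length_mem_SharpP q gQ_mem_FP)

/-- The summand: the weight on accepted pairs `⟨y, z⟩`, `0` elsewhere. [cite: AroraBarak2009, Def. 17.2] -/
def psi (Δ p q : ℕ) (W : List Bool) : ℕ := if W ∈ testLang Δ then weightFn p q W else 0

/-- `psi Δ p q ∈ #P`. [cite: AroraBarak2009, §17.4.2 eq. (17.5)] -/
theorem psi_mem_SharpP (Δ p q : ℕ) : psi Δ p q ∈ SharpP :=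
  ParityClosure.ite_mem_SharpP (weightFn_mem_SharpP p q) (testLang_mem_P Δ)

/-- **The `#P` function on canonical codes**: `φ(y) = Σ_{z ∈ {0,1}^{|gLen y|}} psi ⟨y, z⟩`.
[cite: AroraBarak2009, Def. 17.2] -/
def phi (Δ p q : ℕ) (y : List Bool) : ℕ := ∑ z : List.Vector Bool (gLen y).length, psi Δ p q (boolPair y z.toList)

/-- `phi Δ p q ∈ #P` (uniform exponential sums of a `#P` function). [cite: AroraBarak2009, §17.4.2] -/
theorem phi_mem_SharpP (Δ p q : ℕ) : phi Δ p q ∈ SharpP :=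
  ParityClosure.sum_mem_SharpP (psi_mem_SharpP Δ p q) gLen_mem_FP

/-! ### Bit vectors versus vertex sets -/

/-- The set chosen by a characteristic vector. [folklore] -/
theorem chosen_ofFn {n : ℕ} (f : Fin n → Bool) : chosen n (List.ofFn f) = univ.filter fun i => f i = true := by
  ext i
  simp [chosen]

/-- Bit functions on `Fin n` and subsets of `Fin n`. [folklore] -/
def funEquivFinset (n : ℕ) : (Fin n → Bool) ≃ Finset (Fin n) where
  toFun f := univ.filter fun i => f i = true
  invFun I i := decide (i ∈ I)
  left_inv f := by funext i; simp
  right_inv I := by ext i; simp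

/-- **The sum over witnesses on the code of a graph**: for `|z| = n` the summand is
`[maxDegree ≤ Δ ∧ S_z independent] · p^{|S_z|} q^{n - |S_z|}`, and `z ↦ S_z` is a bijection onto the
subsets of `Fin n`. [cite: Valiant1979, §2] [cite: AroraBarak2009, Def. 17.2] -/
theorem sum_psi_encode (Δ p q : ℕ) {n : ℕ} (G : SimpleGraph (Fin n)) (k : ℕ) (hk : k = n) :
    ∑ z : List.Vector Bool k, psi Δ p q (boolPair (encodingGraph.encode ⟨n, G⟩) z.toList) =
      if G.maxDegree ≤ Δ then
        ∑ I : Finset (Fin n), (if G.IsIndepSet (↑I : Set (Fin n)) then p ^ I.card * q ^ (n - I.card) else 0)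
      else 0 := by
  subst hk
  set y := encodingGraph.encode ⟨k, G⟩ with hy
  -- the summand, witness by witness
  have hψ : ∀ z : List.Vector Bool k, psi Δ p q (boolPair y z.toList) =
      if G.maxDegree ≤ Δ ∧ G.IsIndepSet (↑(chosen k z.toList) : Set (Fin k)) then
        p ^ z.toList.count true * q ^ (k - z.toList.count true) else 0 := by
    intro z
    have hz : z.toList.length = k := z.toList_length
    unfold psi weightFn
    rw [length_gP, length_gQ, hz]
    exact if_congr (mem_testLang_encode_iff G Δ hz) rfl rfl
  simp only [hψ]
  by_cases hdeg : G.maxDegree ≤ Δ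
  · simp only [hdeg, true_and, if_true]
    -- vectors → bit functions → subsets
    rw [← Fintype.sum_equiv (Equiv.vectorEquivFin Bool k).symm
      (fun f : Fin k → Bool => if G.IsIndepSet (↑(chosen k (List.ofFn f)) : Set (Fin k)) then
        p ^ (List.ofFn f).count true * q ^ (k - (List.ofFn f).count true) else 0) _
      (fun f => by simp only [Equiv.vectorEquivFin, Equiv.coe_fn_symm_mk, List.Vector.toList_ofFn])]
    refine Fintype.sum_equiv (funEquivFinset k) _ _ fun f => ?_
    rw [chosen_ofFn, CliqueNP.count_true_ofFn]
    rfl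
  · simp only [hdeg, false_and, if_false, sum_const_zero]

/-- **`φ` on the code of a graph is the hard-core count.** [cite: Valiant1979, §2] -/
theorem phi_encode (Δ p q : ℕ) {n : ℕ} (G : SimpleGraph (Fin n)) :
    phi Δ p q (encodingGraph.encode ⟨n, G⟩) = hardcoreCount Δ p q (encodingGraph.encode ⟨n, G⟩) := by
  have hlen : (gLen (encodingGraph.encode ⟨n, G⟩)).length = n := by rw [gLen_encode, List.length_replicate]
  unfold phi
  rw [sum_psi_encode Δ p q G _ hlen]
  simp only [hardcoreCount, encodingGraph.decode_encode]

/-- **`φ` vanishes on a canonical non-code** (the header test rejects every witness). [folklore] -/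
theorem phi_canon_of_ne (Δ p q : ℕ) {w : List Bool} (h : (sndF w).length ≠ dimW w * dimW w) :
    phi Δ p q (canon w) = 0 := by
  unfold phi
  refine sum_eq_zero fun z _ => ?_
  unfold psi
  rw [if_neg (not_mem_testLang_of_hdrT (hdrT_canon_of_ne h _))]

/-! ### The hard-core count is in `#P` -/

/-- **`N = φ ∘ canon`**: the hard-core count reads its input through the decoder, and `canon` re-encodes
the decoded graph. [cite: Valiant1979, §2] -/
theorem hardcoreCount_eq_phi_comp_canon (Δ p q : ℕ) : hardcoreCount Δ p q = phi Δ p q ∘ canon := by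
  funext w
  rw [Function.comp_apply]
  by_cases h : (sndF w).length = dimW w * dimW w
  · rw [canon_eq_encode h, phi_encode]
    simp only [hardcoreCount, decode_eq_some h, encodingGraph.decode_encode]
  · rw [phi_canon_of_ne Δ p q h]
    simp only [hardcoreCount, decode_eq_none h]

/-- **The hard-core counting function is in `#P`**: `hardcoreCount Δ p q ∈ SharpP` for all `Δ, p, q`
(Valiant's class; `FP` preprocessing by `canon`, then a uniform exponential sum of a `P`-tested product
of uniform products of constants). [cite: Valiant1979, §2] [cite: AroraBarak2009, Def. 17.2] -/
theorem hardcoreCount_mem_SharpP (Δ p q : ℕ) : hardcoreCount Δ p q ∈ SharpP := by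
  rw [hardcoreCount_eq_phi_comp_canon]
  exact comp_mem_SharpP (phi_mem_SharpP Δ p q) canon_mem_FP

end HardcoreSharpP

/-- **Route item `HardcoreCountSharpP` (stmt-PneNP-2722)**: for all `Δ, p, q` the hard-core count
`x ↦ Σ_{I independent in G_x} p^{|I|} q^{n-|I|}` (on codes of graphs of maximum degree `≤ Δ`, `0` off the
promise; the inlined function of route PneNP/PhaseTwins, which is `hardcoreCount Δ p q` verbatim) is in
`#P`. [cite: Valiant1979, §2] [cite: AroraBarak2009, Def. 17.2] -/
theorem hardcoreCountSharpP_proof : Summit.PneNP.PneNP.Theses.PhaseTwins.HardcoreCountSharpP := by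
  unfold Summit.PneNP.PneNP.Theses.PhaseTwins.HardcoreCountSharpP
  intro Δ p q
  exact HardcoreSharpP.hardcoreCount_mem_SharpP Δ p q

end Summit.PneNP.PneNP.Theorems

end
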